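import Literature.Probability.Percolation.QSMColumnModel
import HarnessLib

/-!
# The local modification lemma for the column-enhanced model (Martineau–Severo 2019, Lemma 6.1)

Second file of the inline proof of `Literature.Probability.Percolation.martineauSevero_zd3_slabTorus`.
Martineau–Severo, *Strict monotonicity of percolation thresholds under covering maps*, Ann.
Probab. 47 (2019), §6, derive the Aizenman–Grimmett differential inequality (diffineq)
`∂θ_L/∂s ≥ c ∂θ_L/∂p` from the deterministic

> **Lemma 6.1.** There are constants `R` and `L₀` such that the following holds. If `L ≥ L₀` and
> an edge `e` is `p`-pivotal for `𝓔_L` in a configuration `(ω, α)`, then there exist a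
> configuration `(ω', α')` differing from `(ω, α)` only inside `B_R(e)` and a vertex `z` in
> `B_R(e)` such that `z` is `s`-pivotal for `𝓔_L` in `(ω', α')`.

This file proves the same statement for the column version of the model
(`SlabTorus.InCl`, `SlabTorus.Reaches` of `QSMColumnModel.lean`) on `ℋ_n = C_n □ ℤ²`, `n ≥ 3`:
`SlabTorus.local_modification`. Here `e = s(a, b)` with `‖a.2‖∞ ≤ L`, the modification changes
`ω` only on edges meeting the column `K_c`, `c = a.2` (and only by genuine edges of `ℋ_n`), it only
REMOVES marks, and only marks of `c` and of its four neighbouring columns, and the pivotal column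
`z` is `c` or a neighbour of `c`, of sup-norm `≤ L`; no `L₀` is needed (`R = 1` in column units).

## Proof (Martineau–Severo's, column by column)

Write `ω₁ = ω ∪ {e}`; pivotality gives `𝓔_L(ω₁, α)` and `¬ 𝓔_L(ω₁ ∖ e, α)`.
* *Removing marks* ("remove from `α` all the vertices in `B_R(e)` one by one"): by induction on
  the number of marks of `α` near `c`; if deleting a near mark `y₀` destroys `𝓔_L`, `y₀` is
  `s`-pivotal in `(ω₁, α)` (and `‖y₀‖∞ ≤ L` by locality); otherwise continue with `α ∖ {y₀}`, for
  which `e` is still pivotal. We may thus assume `α` has no mark near `c` (`construction`).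
* *Case b (`o ∈ K_c`) and Case a (`o ∉ K_c`) together*: let `ω̃ = ω₁ ∖ {edges meeting K_c}`
  (M–S: "closing all the edges inside `B_{r+1}(z)`"). If `o ∉ K_c`, no vertex of `K_c` is in
  `𝒞_o(ω̃, α)` (`no_column_vertex`), and some `u ∈ 𝒞_o(ω̃, α)` lies in a column adjacent to `c`
  (`exists_adjacent`, M–S's vertex `u ∈ S_{r+1}(z) ∩ 𝒞_o(ω̃, α')`, found by following the cluster
  of `(ω₁, α)` to the first time it touches `K_c ∪ N_c`, which it does since an endpoint of the
  pivotal edge `e` lies in the cluster: `endpoint_mem`). Put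
  `ω' = ω̃ ∪ E(K_c) ∪ {uv}` with `v ∈ K_c` the neighbour of `u` (no `uv` if `o ∈ K_c`).
  - `¬ 𝓔_L(ω', α)`: `𝒞_o(ω', α) ⊆ 𝒞_o(ω̃, α) ∪ K_c` (`cl_new_subset`), the first set does not reach
    sup-norm `L + 1` because `ω̃ ⊆ ω₁ ∖ e`, and `‖c‖∞ ≤ L`.
  - `𝓔_L(ω', α ∪ {c})`: the bonus of `c` fires (its column is open and reached), swallowing
    `K_c ∪ N_c`; every step of `𝒞_o(ω₁, α)` is then available (`cl_old_subset`: a removed edge has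
    both endpoints in `K_c ∪ N_c`; other bonuses sit `≥ 2` columns away from `c`).
  Hence `c` is `s`-pivotal in `(ω', α)`.

## References

* S. Martineau, F. Severo, Ann. Probab. 47 (2019), §6, Lemma 6.1 and its proof (Cases a, b)
  [MartineauSevero2019].
* M. Aizenman, G. Grimmett, J. Stat. Phys. 63 (1991) 817–835, Lemma 2 (the original local
  modification argument) [AizenmanGrimmett1991].
-/

namespace Literature.Probability.Percolation

open LatticeModels

namespace SlabTorus

variable {n : ℕ}

/-! ### Columns near a column -/

/-- The columns "near" `c`: `c` itself and its four neighbours in `ℤ²` (Martineau–Severo's ball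
`B_R(e)` in which marks are removed). [cite: MartineauSevero2019, §6 Lemma 6.1] -/
def nearCol (c : Site 2) : Set (Site 2) :=
  {y | y = c ∨ (zdGraph 2).Adj c y}

/-- `c` is near `c`. [folklore] -/
theorem self_mem_nearCol (c : Site 2) : c ∈ nearCol c := Or.inl rfl

/-- The set of columns near `c` is finite. [folklore] -/
theorem finite_nearCol (c : Site 2) : (nearCol c).Finite := by
  have h : nearCol c = {c} ∪ (zdGraph 2).neighborSet c := by
    ext y
    simp [nearCol, SimpleGraph.mem_neighborSet]
  rw [h]
  exact (Set.finite_singleton c).union (Set.toFinite _)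

/-! ### Pivotality of an edge forces an endpoint into the cluster -/

/-- If neither endpoint of `e = s(a, b)` belongs to the enhanced cluster of `(ω, α)`, then the
cluster does not use `e`: it is also the cluster of `(ω ∖ {e}, α)`. [folklore] -/
theorem InCl.diff_singleton_of_not_mem [NeZero n] (hn : n ≠ 1) {L : ℕ} {ω : Set (Sym2 (Vert n))}
    {α : Set (Site 2)} {a b : Vert n} (ha : ¬ InCl L ω α a) (hb : ¬ InCl L ω α b) {v : Vert n}
    (hv : InCl L ω α v) : InCl L (ω \ {s(a, b)}) α v := by
  induction hv with
  | origin => exact InCl.origin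
  | @edge a' b' ha' hab he hL ih =>
    refine InCl.edge ih hab ⟨he, ?_⟩ hL
    intro heq
    rw [Set.mem_singleton_iff, Sym2.eq_iff] at heq
    rcases heq with ⟨rfl, -⟩ | ⟨rfl, -⟩
    · exact ha ha'
    · exact hb ha'
  | @bonus a' b' ha' hα hL hcyc hadj ih =>
    refine InCl.bonus ih hα hL (fun t => ⟨hcyc t, ?_⟩) hadj
    intro heq
    rw [Set.mem_singleton_iff, Sym2.eq_iff] at heq
    have hcol : ∀ t' : ZMod n, InCl L ω α (t', a'.2) := InCl.column hn ha' hL hcyc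
    rcases heq with ⟨h1, -⟩ | ⟨-, h2⟩
    · exact ha (h1 ▸ hcol t)
    · exact ha (h2 ▸ hcol (t + 1))

/-- If `e = s(a, b)` is pivotal for `𝓔_L` — `𝓔_L(ω, α)` but not `𝓔_L(ω ∖ e, α)` — then an endpoint of
`e` lies in the enhanced cluster of `(ω, α)` (Martineau–Severo: "Since `e` is `p`-pivotal …").
[cite: MartineauSevero2019, §6 Lemma 6.1 (proof)] -/
theorem endpoint_mem [NeZero n] (hn : n ≠ 1) {L : ℕ} {ω : Set (Sym2 (Vert n))} {α : Set (Site 2)}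
    {a b : Vert n} (h1 : Reaches L ω α) (h2 : ¬ Reaches L (ω \ {s(a, b)}) α) :
    InCl L ω α a ∨ InCl L ω α b := by
  by_contra h
  rw [not_or] at h
  obtain ⟨v, hv, hL⟩ := h1
  exact h2 ⟨v, hv.diff_singleton_of_not_mem hn h.1 h.2, hL⟩

/-! ### The construction when no mark is near the column -/

section Construction

variable {L : ℕ} {ω₁ : Set (Sym2 (Vert n))} {α : Set (Site 2)} {c : Site 2}

/-- The configuration `ω̃`: all edges meeting the column `K_c` closed (Martineau–Severo's
`ω̃ := ω ∖ E(B_{r+1}(z))`). [cite: MartineauSevero2019, §6 Lemma 6.1 (proof, Case a)] -/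
def closedAt (ω₁ : Set (Sym2 (Vert n))) (c : Site 2) : Set (Sym2 (Vert n)) :=
  {f | f ∈ ω₁ ∧ f ∉ colE n c}

/-- `ω̃ ⊆ ω₁`. [folklore] -/
theorem closedAt_subset (ω₁ : Set (Sym2 (Vert n))) (c : Site 2) : closedAt ω₁ c ⊆ ω₁ :=
  fun _ hf => hf.1

/-- With no mark near `c` and `o ∉ K_c`, no vertex of the column `K_c` lies in `𝒞_o(ω̃, α)`: there
is no open edge at `K_c` and no bonus of an adjacent column. [cite: MartineauSevero2019, §6 Lemma 6.1 (proof, Case a)] -/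
theorem no_column_vertex (hα : ∀ y ∈ α, y ∉ nearCol c) {v : Vert n}
    (hv : InCl L (closedAt ω₁ c) α v) (hvc : v.2 = c) : (0 : Site 2) = c := by
  induction hv with
  | origin => simpa [origin] using hvc
  | @edge a' b' _ hab he _ _ =>
    exact absurd (mk_mem_colE_iff.2 (Or.inr hvc)) he.2
  | @bonus a' b' _ hαa _ _ hadj _ =>
    exact absurd (Or.inr (hvc ▸ hadj.symm) : a'.2 ∈ nearCol c) (hα _ hαa)

/-- With no mark near `c` and `o ∉ K_c`: every vertex of `𝒞_o(ω₁, α)` either lies in `𝒞_o(ω̃, α)`,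
or `𝒞_o(ω̃, α)` contains a vertex of a column adjacent to `c` (follow the cluster until it first
touches `K_c ∪ N_c`; Martineau–Severo's vertex `u ∈ S_{r+1}(z)`).
[cite: MartineauSevero2019, §6 Lemma 6.1 (proof, Case a: choice of u)] -/
theorem mem_closedAt_or_exists_adjacent (hα : ∀ y ∈ α, y ∉ nearCol c) (hc : (0 : Site 2) ≠ c)
    {v : Vert n} (hv : InCl L ω₁ α v) :
    InCl L (closedAt ω₁ c) α v ∨ ∃ u : Vert n, InCl L (closedAt ω₁ c) α u ∧ (zdGraph 2).Adj c u.2 := by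
  induction hv with
  | origin => exact Or.inl InCl.origin
  | @edge a' b' _ hab he hL ih =>
    rcases ih with ha' | hu
    · by_cases hcol : s(a', b') ∈ colE n c
      · -- the edge meets `K_c`; `a'` is not in `K_c`, so `a'` is in an adjacent column
        rcases mk_mem_colE_iff.1 hcol with h | h
        · exact absurd (no_column_vertex hα ha' h) hc
        · refine Or.inr ⟨a', ha', ?_⟩
          rcases col_eq_or_adj_of_adj hab with h' | h'
          · exact absurd (no_column_vertex hα ha' (h'.trans h)) hc
          · exact h ▸ h'.symm
      · exact Or.inl (InCl.edge ha' hab ⟨he, hcol⟩ hL)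
    · exact Or.inr hu
  | @bonus a' b' _ hαa hL hcyc hadj ih =>
    rcases ih with ha' | hu
    · refine Or.inl (InCl.bonus ha' hαa hL (fun t => ⟨hcyc t, fun hcol => ?_⟩) hadj)
      have : a'.2 = c := eq_of_cycE_of_colE ⟨t, rfl⟩ hcol
      exact hα _ hαa (this ▸ self_mem_nearCol _)
    · exact Or.inr hu

/-- Existence of the attachment vertex `u`: if `o ∉ K_c`, no mark is near `c`, and an edge meeting
`K_c` is pivotal in `(ω₁, α)`, then `𝒞_o(ω̃, α)` contains a vertex `u` of a column adjacent to `c`.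
[cite: MartineauSevero2019, §6 Lemma 6.1 (proof, Case a: choice of u)] -/
theorem exists_adjacent [NeZero n] (hn : n ≠ 1) (hα : ∀ y ∈ α, y ∉ nearCol c) (hc : (0 : Site 2) ≠ c) {a b : Vert n}
    (hab : (slabTorusGraph n).Adj a b) (hac : a.2 = c)
    (h1 : Reaches L ω₁ α) (h2 : ¬ Reaches L (ω₁ \ {s(a, b)}) α) :
    ∃ u : Vert n, InCl L (closedAt ω₁ c) α u ∧ (zdGraph 2).Adj c u.2 := by
  rcases endpoint_mem hn h1 h2 with hx | hx
  · rcases mem_closedAt_or_exists_adjacent hα hc hx with hx' | hu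
    · exact absurd (no_column_vertex hα hx' hac) hc
    · exact hu
  · rcases mem_closedAt_or_exists_adjacent hα hc hx with hx' | hu
    · rcases col_eq_or_adj_of_adj hab with h | h
      · exact absurd (no_column_vertex hα hx' (h ▸ hac)) hc
      · exact ⟨b, hx', hac ▸ h⟩
    · exact hu

/-- The modified configuration `ω' = ω̃ ∪ E(K_c) ∪ F` (`F` = the attaching edge `uv`, or nothing).
[cite: MartineauSevero2019, §6 Lemma 6.1 (proof: definition of ω')] -/
def modified (ω₁ : Set (Sym2 (Vert n))) (c : Site 2) (F : Set (Sym2 (Vert n))) : Set (Sym2 (Vert n)) :=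
  closedAt ω₁ c ∪ cycE n c ∪ F

/-- **`𝒞_o(ω', α) ⊆ 𝒞_o(ω̃, α) ∪ K_c`** when no mark is near `c` and every edge of `F` joins a
vertex of `𝒞_o(ω̃, α)` to a vertex of `K_c` (Martineau–Severo: "`𝒞_o(ω', α') = 𝒞_o(ω̃, α') ∪ B_r(z)`
… we do not add any extra vertex in even steps"). [cite: MartineauSevero2019, §6 Lemma 6.1 (proof)] -/
theorem cl_new_subset (hα : ∀ y ∈ α, y ∉ nearCol c) {F : Set (Sym2 (Vert n))}
    (hF : ∀ f ∈ F, ∃ u v : Vert n, f = s(u, v) ∧ InCl L (closedAt ω₁ c) α u ∧ v.2 = c)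
    {w : Vert n} (hw : InCl L (modified ω₁ c F) α w) : InCl L (closedAt ω₁ c) α w ∨ w.2 = c := by
  induction hw with
  | origin => exact Or.inl InCl.origin
  | @edge a' b' _ hab he hL ih =>
    rcases he with (he | ⟨t, he⟩) | he
    · -- an edge of `ω̃`: its endpoint `a'` is not in `K_c`
      rcases ih with ha' | ha'
      · exact Or.inl (InCl.edge ha' hab he hL)
      · exact absurd (mk_mem_colE_iff.2 (Or.inl ha')) he.2
    · -- a cycle edge of `K_c`
      right
      rcases (Sym2.eq_iff.1 he) with ⟨-, rfl⟩ | ⟨-, rfl⟩ <;> rfl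
    · -- an edge of `F`
      obtain ⟨u, v, hf, hu, hv⟩ := hF _ he
      rcases (Sym2.eq_iff.1 hf) with ⟨-, rfl⟩ | ⟨-, rfl⟩
      · exact Or.inr hv
      · exact Or.inl hu
  | @bonus a' b' _ hαa hL hcyc hadj ih =>
    have hac : a'.2 ≠ c := fun h => hα _ hαa (h ▸ self_mem_nearCol _)
    rcases ih with ha' | ha'
    · refine Or.inl (InCl.bonus ha' hαa hL (fun t => ?_) hadj)
      rcases hcyc t with (h | ⟨t', h⟩) | h
      · exact h
      · exact absurd (eq_of_cycE_of_colE ⟨t, rfl⟩ (h ▸ cycE_subset_colE c ⟨t', rfl⟩)) hac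
      · obtain ⟨u, v, hf, -, hv⟩ := hF _ h
        exfalso
        apply hac
        rcases (Sym2.eq_iff.1 hf) with ⟨-, h2⟩ | ⟨h1, -⟩
        · have := congrArg Prod.snd h2
          simp only at this
          exact this.trans hv
        · have := congrArg Prod.snd h1
          simp only at this
          exact this.trans hv
    · exact absurd ha' hac

/-- **`𝒞_o(ω₁, α) ⊆ 𝒞_o(ω', α ∪ {c})`** when no mark is near `c`, `‖c‖∞ ≤ L`, and some vertex of `K_c`
lies in `𝒞_o(ω', α ∪ {c})`: the bonus of `c` fires and swallows `K_c ∪ N_c`, after which every step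
of the old cluster is available (Martineau–Severo: "`𝒞_o(ω, α') ⊆ 𝒞_{B_{r+1}(z) ∪ {o}}(ω, α') ⊆
𝒞_{B_{r+1}(z) ∪ {o}}(ω', α' ∪ {z}) = 𝒞_o(ω', α' ∪ {z})`").
[cite: MartineauSevero2019, §6 Lemma 6.1 (proof, last paragraph)] -/
theorem cl_old_subset [NeZero n] (hn : n ≠ 1) (hα : ∀ y ∈ α, y ∉ nearCol c) (hcL : pnorm c ≤ L) {F : Set (Sym2 (Vert n))}
    {w₀ : Vert n} (hw₀ : InCl L (modified ω₁ c F) (insert c α) w₀) (hw₀c : w₀.2 = c)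
    {w : Vert n} (hw : InCl L ω₁ α w) : InCl L (modified ω₁ c F) (insert c α) w := by
  -- the bonus of `c` fires: `K_c ∪ N_c` is swallowed
  have hcyc : ∀ t : ZMod n, s((t, w₀.2), (t + 1, w₀.2)) ∈ modified ω₁ c F := fun t =>
    Or.inl (Or.inr ⟨t, by rw [hw₀c]⟩)
  have hKc : ∀ t : ZMod n, InCl L (modified ω₁ c F) (insert c α) (t, c) := fun t =>
    hw₀c ▸ InCl.column hn hw₀ (hw₀c ▸ hcL) hcyc t
  have hNc : ∀ (t : ZMod n) (y : Site 2), (zdGraph 2).Adj c y →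
      InCl L (modified ω₁ c F) (insert c α) (t, y) := fun t y hy =>
    InCl.bonus' hw₀ (hw₀c ▸ Set.mem_insert c α) (hw₀c ▸ hcL) hcyc t (hw₀c ▸ hy)
  have hnear : ∀ v : Vert n, (v.2 = c ∨ (zdGraph 2).Adj c v.2) →
      InCl L (modified ω₁ c F) (insert c α) v := by
    rintro ⟨t, y⟩ (h | h)
    · simp only at h
      exact h ▸ hKc t
    · exact hNc t y h
  induction hw with
  | origin => exact InCl.origin
  | @edge a' b' _ hab he hL ih =>
    by_cases hcol : s(a', b') ∈ colE n c
    · exact hnear b' (col_near_of_adj_of_colE hab hcol).1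
    · exact InCl.edge ih hab (Or.inl (Or.inl ⟨he, hcol⟩)) hL
  | @bonus a' b' _ hαa hL hcyc' hadj ih =>
    have hac : a'.2 ≠ c := fun h => hα _ hαa (h ▸ self_mem_nearCol _)
    refine InCl.bonus ih (Set.mem_insert_of_mem _ hαa) hL (fun t => ?_) hadj
    refine Or.inl (Or.inl ⟨hcyc' t, fun hcol => hac ?_⟩)
    exact eq_of_cycE_of_colE ⟨t, rfl⟩ hcol

/-- **The construction.** No mark near `c`, `‖c‖∞ ≤ L`, an edge `s(a, b)` with `a ∈ K_c` pivotal in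
`(ω₁, α)`: then `c` is `s`-pivotal for `𝓔_L` in `(ω', α)` for a configuration `ω'` that differs from
`ω₁` only on edges meeting `K_c`, the new ones being edges of `ℋ_n`.
[cite: MartineauSevero2019, §6 Lemma 6.1 (proof, Cases a and b)] -/
theorem construction [NeZero n] (hn : n ≠ 1) (hα : ∀ y ∈ α, y ∉ nearCol c) (hcL : pnorm c ≤ L) {a b : Vert n}
    (hab : (slabTorusGraph n).Adj a b) (hac : a.2 = c)
    (h1 : Reaches L ω₁ α) (h2 : ¬ Reaches L (ω₁ \ {s(a, b)}) α) :
    ∃ ω' : Set (Sym2 (Vert n)),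
      (∀ f, f ∉ colE n c → (f ∈ ω' ↔ f ∈ ω₁)) ∧
      (∀ f ∈ ω', f ∉ ω₁ → f ∈ (slabTorusGraph n).edgeSet) ∧
      Reaches L ω' (insert c α) ∧ ¬ Reaches L ω' α := by
  -- the attaching edge(s) `F` and a seed vertex of `K_c` in the new cluster
  obtain ⟨F, hF, hFE, hFcol, hseed⟩ : ∃ F : Set (Sym2 (Vert n)),
      (∀ f ∈ F, ∃ u v : Vert n, f = s(u, v) ∧ InCl L (closedAt ω₁ c) α u ∧ v.2 = c) ∧
      (F ⊆ (slabTorusGraph n).edgeSet) ∧ (F ⊆ colE n c) ∧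
      ∃ w₀ : Vert n, InCl L (modified ω₁ c F) (insert c α) w₀ ∧ w₀.2 = c := by
    by_cases hc : (0 : Site 2) = c
    · refine ⟨∅, by simp, by simp, by simp, origin n, InCl.origin, ?_⟩
      simpa [origin] using hc
    · obtain ⟨u, hu, hcu⟩ := exists_adjacent hn hα hc hab hac h1 h2
      have huv : (slabTorusGraph n).Adj u (u.1, c) := adj_horizontal u.1 hcu.symm
      refine ⟨{s(u, (u.1, c))}, ?_, ?_, ?_, (u.1, c), ?_, rfl⟩
      · intro f hf
        rw [Set.mem_singleton_iff] at hf
        exact ⟨u, (u.1, c), hf, hu, rfl⟩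
      · intro f hf
        rw [Set.mem_singleton_iff] at hf
        rw [hf]
        exact huv
      · intro f hf
        rw [Set.mem_singleton_iff] at hf
        rw [hf]
        exact mk_mem_colE_iff.2 (Or.inr rfl)
      · have hu' : InCl L (modified ω₁ c {s(u, (u.1, c))}) (insert c α) u :=
          (hu.mono (fun f hf => Or.inl (Or.inl hf)) (Set.subset_insert c α))
        exact InCl.edge hu' huv (Or.inr rfl) (Or.inr hcL)
  refine ⟨modified ω₁ c F, ?_, ?_, ?_, ?_⟩
  · -- only edges meeting `K_c` change
    intro f hf
    simp only [modified, closedAt, Set.mem_union, Set.mem_setOf_eq]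
    constructor
    · rintro ((⟨h, -⟩ | h) | h)
      · exact h
      · exact absurd (cycE_subset_colE c h) hf
      · exact absurd (hFcol h) hf
    · intro h
      exact Or.inl (Or.inl ⟨h, hf⟩)
  · -- new edges are edges of the graph
    intro f hf hf1
    simp only [modified, closedAt, Set.mem_union, Set.mem_setOf_eq] at hf
    rcases hf with ((⟨h, -⟩ | ⟨t, rfl⟩) | h)
    · exact absurd h hf1
    · exact adj_vertical hn t c
    · exact hFE h
  · -- `𝓔_L(ω', α ∪ {c})`
    obtain ⟨w₀, hw₀, hw₀c⟩ := hseed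
    obtain ⟨v, hv, hvL⟩ := h1
    exact ⟨v, cl_old_subset hn hα hcL hw₀ hw₀c hv, hvL⟩
  · -- `¬ 𝓔_L(ω', α)`
    rintro ⟨v, hv, hvL⟩
    rcases cl_new_subset hα hF hv with hv' | hv'
    · have hsub : closedAt ω₁ c ⊆ ω₁ \ {s(a, b)} := by
        intro f hf
        refine ⟨hf.1, fun hfe => ?_⟩
        rw [Set.mem_singleton_iff] at hfe
        exact hf.2 (hfe ▸ mk_mem_colE_iff.2 (Or.inl hac))
      exact h2 ⟨v, hv'.mono hsub le_rfl, hvL⟩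
    · rw [hv'] at hvL
      omega

end Construction

/-! ### The lemma -/

/-- **Martineau–Severo 2019, Lemma 6.1 (column version on `ℋ_n = C_n □ ℤ²`, `n ≥ 3`).** If the edge
`e = s(a, b)` of `ℋ_n`, with `‖a.2‖∞ ≤ L`, is pivotal for `𝓔_L` in `(ω, α)` — `𝓔_L(ω ∪ e, α)` and
`¬ 𝓔_L(ω ∖ e, α)` — then there are `ω'`, `α'` and a column `y` such that: `ω'` agrees with `ω` off the
edges meeting the column `c = a.2`, and the edges of `ω'` not in `ω` are edges of `ℋ_n`; `α' ⊆ α`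
and `α ∖ α'` consists of columns near `c`; `y` is near `c`, `‖y‖∞ ≤ L`; and `y` is `s`-pivotal for
`𝓔_L` in `(ω', α')`: `𝓔_L(ω', α' ∪ {y})` and `¬ 𝓔_L(ω', α' ∖ {y})`.
[cite: MartineauSevero2019, §6 Lemma 6.1] -/
theorem local_modification (hn : 3 ≤ n) {L : ℕ} {ω : Set (Sym2 (Vert n))} {α : Set (Site 2)}
    {a b : Vert n} (hab : (slabTorusGraph n).Adj a b) (haL : pnorm a.2 ≤ L)
    (h1 : Reaches L (insert s(a, b) ω) α) (h2 : ¬ Reaches L (ω \ {s(a, b)}) α) :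
    ∃ (ω' : Set (Sym2 (Vert n))) (α' : Set (Site 2)) (y : Site 2),
      (∀ f, f ∉ colE n a.2 → (f ∈ ω' ↔ f ∈ ω)) ∧
      (∀ f ∈ ω', f ∉ ω → f ∈ (slabTorusGraph n).edgeSet) ∧
      α' ⊆ α ∧ (∀ y' ∈ α, y' ∉ α' → y' ∈ nearCol a.2) ∧
      y ∈ nearCol a.2 ∧ pnorm y ≤ L ∧
      Reaches L ω' (insert y α') ∧ ¬ Reaches L ω' (α' \ {y}) := by
  haveI : NeZero n := ⟨by omega⟩
  have hn1 : n ≠ 1 := by omega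
  set c := a.2 with hc
  -- induction on the number of marks near `c`
  suffices key : ∀ (k : ℕ) (β : Set (Site 2)), (β ∩ nearCol c).ncard = k → β ⊆ α →
      Reaches L (insert s(a, b) ω) β →
      ∃ (ω' : Set (Sym2 (Vert n))) (α' : Set (Site 2)) (y : Site 2),
        (∀ f, f ∉ colE n c → (f ∈ ω' ↔ f ∈ ω)) ∧
        (∀ f ∈ ω', f ∉ ω → f ∈ (slabTorusGraph n).edgeSet) ∧
        α' ⊆ β ∧ (∀ y' ∈ β, y' ∉ α' → y' ∈ nearCol c) ∧
        y ∈ nearCol c ∧ pnorm y ≤ L ∧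
        Reaches L ω' (insert y α') ∧ ¬ Reaches L ω' (α' \ {y}) by
    obtain ⟨ω', α', y, h1', h2', h3', h4', h5', h6', h7', h8'⟩ := key _ α rfl le_rfl h1
    exact ⟨ω', α', y, h1', h2', h3', h4', h5', h6', h7', h8'⟩
  intro k
  induction k using Nat.strong_induction_on with
  | _ k ih =>
    intro β hk hβα hβ1
    have hβ2 : ¬ Reaches L (ω \ {s(a, b)}) β := fun h => h2 (h.mono le_rfl hβα)
    have hfin : (β ∩ nearCol c).Finite := (finite_nearCol c).subset Set.inter_subset_right
    by_cases hempty : β ∩ nearCol c = ∅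
    · -- no mark near `c`: the construction
      have hβ : ∀ y ∈ β, y ∉ nearCol c := fun y hy hy' =>
        (Set.ext_iff.1 hempty y).1 ⟨hy, hy'⟩
      have h2' : ¬ Reaches L (insert s(a, b) ω \ {s(a, b)}) β := by
        intro h
        refine hβ2 (h.mono (fun f hf => ?_) le_rfl)
        simp only [Set.mem_sdiff, Set.mem_insert_iff, Set.mem_singleton_iff] at hf ⊢
        tauto
      obtain ⟨ω', hω'1, hω'2, hR, hnR⟩ := construction hn1 hβ haL hab rfl hβ1 h2'
      refine ⟨ω', β, c, fun f hf => ?_, fun f hf hfω => ?_, le_rfl, fun y' hy' h => absurd hy' h,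
        self_mem_nearCol c, haL, hR, fun h => hnR (h.mono le_rfl Set.sdiff_subset)⟩
      · rw [hω'1 f hf, Set.mem_insert_iff, or_iff_right]
        rintro rfl
        exact hf (mk_mem_colE_iff.2 (Or.inl rfl))
      · by_cases hfe : f = s(a, b)
        · rw [hfe]
          exact (SimpleGraph.mem_edgeSet _).2 hab
        · exact hω'2 f hf fun h => (Set.mem_insert_iff.1 h).elim hfe hfω
    · -- remove one mark near `c`
      obtain ⟨y₀, hy₀β, hy₀c⟩ : (β ∩ nearCol c).Nonempty := Set.nonempty_iff_ne_empty.2 hempty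
      by_cases hstill : Reaches L (insert s(a, b) ω) (β \ {y₀})
      · -- `e` is still pivotal for `β ∖ {y₀}`: induction
        have hlt : ((β \ {y₀}) ∩ nearCol c).ncard < k := by
          rw [← hk]
          refine Set.ncard_lt_ncard ?_ hfin
          refine ⟨fun y hy => ⟨hy.1.1, hy.2⟩, fun h => ?_⟩
          exact (h ⟨hy₀β, hy₀c⟩).1.2 rfl
        obtain ⟨ω', α', y, h1', h2', h3', h4', h5', h6', h7', h8'⟩ :=
          ih _ hlt (β \ {y₀}) rfl (Set.sdiff_subset.trans hβα) hstill
        refine ⟨ω', α', y, h1', h2', h3'.trans Set.sdiff_subset, fun y' hy' hy'α => ?_, h5', h6', h7', h8'⟩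
        by_cases hyy : y' = y₀
        · exact hyy ▸ hy₀c
        · exact h4' y' ⟨hy', hyy⟩ hy'α
      · -- `y₀` is pivotal in `(ω ∪ e, β)`
        have hy₀L : pnorm y₀ ≤ L := by
          by_contra hL
          refine hstill (hβ1.congr hn1 (fun _ _ h => h) fun y hy hyβ => ⟨hyβ, ?_⟩)
          rintro rfl
          exact hL hy
        refine ⟨insert s(a, b) ω, β, y₀, fun f hf => ?_, fun f hf hfω => ?_, le_rfl,
          fun y' hy' h => absurd hy' h, hy₀c, hy₀L, ?_, hstill⟩
        · rw [Set.mem_insert_iff, or_iff_right]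
          rintro rfl
          exact hf (mk_mem_colE_iff.2 (Or.inl rfl))
        · rcases (Set.mem_insert_iff.1 hf) with rfl | h
          · exact (SimpleGraph.mem_edgeSet _).2 hab
          · exact absurd h hfω
        · rwa [Set.insert_eq_of_mem hy₀β]

end SlabTorus

end Literature.Probability.Percolation
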